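import Literature.MathematicalPhysics.QuantumFieldTheory.CurvatureGaussianField
import Mathlib.Analysis.SpecialFunctions.Gaussian.GaussianIntegral
import Mathlib.Probability.Distributions.Gaussian.HasGaussianLaw.Independence
import HarnessLib

/-!
# Stub `stub_gaussianProfile` of line `Sketch` (crux `stmt-QuantumFields-8760`)

Route `EquipartitionCriticality` of `YangMills`, crux item `stmt-QuantumFields-8760`
(`Summit.QuantumFields.YangMills.Theses.EquipartitionCriticality.EquipartitionPinsProbe`), line
`Sketch`, stub `stub_gaussianProfile` of the lead's skeleton.

What is proved: under the tree's curvature Gaussian field `ν := curvatureGaussianField 4 D`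
(`D` i.i.d. colour copies of the lattice Maxwell field strength on the plaquettes of `ℤ⁴`), the
covariance of the probes `e^{-|Y_{p₀}|²}` and `e^{-|Y_{p_n}|²}` at the plaquettes
`p₀ = (0; 1, 2)` and `p_n = (n e₀; 1, 2)` is `2^{-D} ((1 - c_n²)^{-D/2} - 1)`,
`c_n = curvaturePlaquetteCorr _ n` the plaquette two-point number
(`GaussianProfile.covariance_formula`, stated for any two plaquettes `p, q` with
`c = curvatureTwoPoint p q`).

Proof: (1) the one-dimensional integral `E[e^{-s Z²}] = (1 + 2 s v)^{-1/2}` for `Z ∼ N(0, v)`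
(`integral_gaussian`); (2) a real Gaussian process is determined in law by its mean and
covariance functions (tree `IsGaussianProcess.map_eq_of_covariance_eq`, Kallenberg Lemma 13.1),
packaged for two processes on different probability spaces via the product space
(`GaussianProfile.map_eq_map_of_isGaussianProcess`); (3) the `Fin D ⊕ Fin D`-indexed family
`(Y_p^a, Y_q^a)_a` under `ν` is a centred Gaussian process with covariances `δ_{ab}/2` on the
diagonal blocks and `δ_{ab} c` off them (tree `covariance_eval_curvatureGaussianField`,
`curvatureTwoPoint_self`), and so is the explicit model `(ξ_a + η_a, ξ_a - η_a)_a` with independent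
`ξ_a ∼ N(0, (1/2 + c)/2)`, `η_a ∼ N(0, (1/2 - c)/2)` (`|c| ≤ 1/2` by positivity of variances);
hence `E_ν[e^{-s|Y_p|²} e^{-s|Y_q|²}] = E[∏_a e^{-2s ξ_a²} e^{-2s η_a²}]`
`= (1 + 2s(1/2 + c))^{-D/2} (1 + 2s(1/2 - c))^{-D/2}`
(`MeasureTheory.integral_fintype_prod_eq_prod`); `s = 1` gives the joint moment
`2^{-D} (1 - c²)^{-D/2}` and `s = 1/2`, `q = p` (`c = 1/2`) gives `E_ν[e^{-|Y_p|²}] = 2^{-D/2}`.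
Only proved tree facts and Mathlib are used.
-/

noncomputable section

open MeasureTheory ProbabilityTheory

namespace Summit.QuantumFields.YangMills.Theorems.EquipartitionPinsProbe

namespace GaussianProfile

open scoped NNReal
open Literature.MathematicalPhysics.QuantumFieldTheory Literature.MathematicalPhysics.QuantumLattice

/-! ### The one-dimensional Gaussian integral -/

/-- `E[e^{-s Z²}] = (1 + 2 s v)^{-1/2}` for `Z ∼ N(0, v)` and `s ≥ 0` (including the degenerate
`v = 0`). -/
theorem integral_exp_neg_mul_sq (v : ℝ≥0) {s : ℝ} (hs : 0 ≤ s) :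
    ∫ x, Real.exp (-(s * x ^ 2)) ∂gaussianReal 0 v = (1 + 2 * s * v) ^ (-(1 / 2 : ℝ)) := by
  rcases eq_or_ne v 0 with rfl | hv
  · simp
  have hv' : (0 : ℝ) < v := NNReal.coe_pos.2 (pos_iff_ne_zero.2 hv)
  have hv0 : (v : ℝ) ≠ 0 := hv'.ne'
  have hπ : Real.pi ≠ 0 := Real.pi_pos.ne'
  have hb : 0 < 1 / (2 * (v : ℝ)) + s := by positivity
  have hb0 : 1 / (2 * (v : ℝ)) + s ≠ 0 := hb.ne'
  rw [integral_gaussianReal_eq_integral_smul hv]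
  simp only [gaussianPDFReal, smul_eq_mul, sub_zero]
  have h : ∀ x : ℝ, (√(2 * Real.pi * v))⁻¹ * Real.exp (-x ^ 2 / (2 * v)) *
      Real.exp (-(s * x ^ 2)) = (√(2 * Real.pi * v))⁻¹ * Real.exp (-(1 / (2 * v) + s) * x ^ 2) := by
    intro x
    rw [mul_assoc, ← Real.exp_add]
    congr 2
    ring
  simp_rw [h]
  have h2 : (0 : ℝ) ≤ (2 * Real.pi * v)⁻¹ := by positivity
  rw [integral_const_mul, integral_gaussian, Real.rpow_neg (by positivity), ← Real.sqrt_eq_rpow,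
    ← Real.sqrt_inv, ← Real.sqrt_inv, ← Real.sqrt_mul h2]
  congr 1
  field_simp

/-! ### Products of centred Gaussians: the model probability space -/

variable {ι : Type*} [Fintype ι]

/-- The coordinates of a product of centred real Gaussians have Gaussian laws. -/
theorem hasGaussianLaw_eval_pi (v : ι → ℝ≥0) (i : ι) :
    HasGaussianLaw (fun z : ι → ℝ => z i) (Measure.pi fun j => gaussianReal 0 (v j)) :=
  (measurePreserving_eval (fun j => gaussianReal 0 (v j)) i).hasLaw.hasGaussianLaw

/-- The coordinate process of a product of centred real Gaussians is a Gaussian process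
(independent Gaussians are jointly Gaussian). -/
theorem isGaussianProcess_eval_pi (v : ι → ℝ≥0) :
    IsGaussianProcess (fun (i : ι) (z : ι → ℝ) => z i) (Measure.pi fun j => gaussianReal 0 (v j)) :=
  ⟨fun I => iIndepFun.hasGaussianLaw (fun i : I => hasGaussianLaw_eval_pi v i.1)
    ((iIndepFun_pi (μ := fun j => gaussianReal 0 (v j)) (X := fun _ x => x)
      fun _ => aemeasurable_id).precomp Subtype.val_injective)⟩

/-- The coordinates of a product of centred real Gaussians are centred. -/
theorem integral_eval_pi (v : ι → ℝ≥0) (i : ι) :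
    ∫ z, z i ∂Measure.pi (fun j => gaussianReal 0 (v j)) = 0 := by
  rw [integral_eval]
  exact integral_id_gaussianReal

/-- The covariances of the coordinates of a product of centred real Gaussians: `δ_{ij} v_i`. -/
theorem covariance_eval_pi [DecidableEq ι] (v : ι → ℝ≥0) (i j : ι) :
    cov[fun z => z i, fun z => z j; Measure.pi fun k => gaussianReal 0 (v k)] =
      if i = j then (v i : ℝ) else 0 := by
  split_ifs with h
  · subst h
    rw [covariance_self (measurable_pi_apply i).aemeasurable]
    simpa [Function.eval] using (measurePreserving_eval (fun k => gaussianReal 0 (v k))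
      i).variance_fun_comp (f := fun x : ℝ => x) aemeasurable_id
  · exact ((iIndepFun_pi (μ := fun k => gaussianReal 0 (v k)) (X := fun _ x => x)
      fun _ => aemeasurable_id).indepFun h).covariance_eq_zero
      (hasGaussianLaw_eval_pi v i).memLp_two (hasGaussianLaw_eval_pi v j).memLp_two

/-- Covariances of the model variables `ξ_a + ε η_a` built from independent centred Gaussians
`ξ_a = z (inl a)`, `η_a = z (inr a)`:
`Cov(ξ_a + ε η_a, ξ_{a'} + ε' η_{a'}) = δ_{aa'} (v_ξ + ε ε' v_η)`. -/
theorem covariance_model (D : ℕ) (v : Fin D ⊕ Fin D → ℝ≥0) (a a' : Fin D) (ε ε' : ℝ) :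
    cov[fun z => z (Sum.inl a) + ε * z (Sum.inr a), fun z => z (Sum.inl a') + ε' * z (Sum.inr a');
        Measure.pi fun k => gaussianReal 0 (v k)] =
      if a = a' then (v (Sum.inl a) : ℝ) + ε * ε' * v (Sum.inr a) else 0 := by
  have hm : ∀ i, MemLp (fun z : Fin D ⊕ Fin D → ℝ => z i) 2
      (Measure.pi fun k => gaussianReal 0 (v k)) := fun i => (hasGaussianLaw_eval_pi v i).memLp_two
  rw [show (fun z : Fin D ⊕ Fin D → ℝ => z (Sum.inl a) + ε * z (Sum.inr a)) =
      (fun z => z (Sum.inl a)) + fun z => ε * z (Sum.inr a) from rfl,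
    show (fun z : Fin D ⊕ Fin D → ℝ => z (Sum.inl a') + ε' * z (Sum.inr a')) =
      (fun z => z (Sum.inl a')) + fun z => ε' * z (Sum.inr a') from rfl,
    covariance_add_left (hm _) ((hm _).const_mul ε) ((hm _).add ((hm _).const_mul ε')),
    covariance_add_right (hm _) (hm _) ((hm _).const_mul ε'),
    covariance_add_right ((hm _).const_mul ε) (hm _) ((hm _).const_mul ε'),
    covariance_const_mul_left, covariance_const_mul_left, covariance_const_mul_right,
    covariance_const_mul_right, covariance_eval_pi, covariance_eval_pi, covariance_eval_pi,
    covariance_eval_pi]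
  by_cases h : a = a'
  · subst h
    simp only [↓reduceIte, reduceCtorEq, mul_zero, add_zero, zero_add]
    ring
  · simp [h]

/-! ### Gaussian laws are determined by means and covariances (two probability spaces) -/

/-- Pulling a real Gaussian process back along a measure-preserving map gives a Gaussian process. -/
theorem isGaussianProcess_comp_measurePreserving {T Ω Ω' : Type*} [MeasurableSpace Ω]
    [MeasurableSpace Ω'] {P : Measure Ω} {Q : Measure Ω'} {X : T → Ω → ℝ}
    (hX : IsGaussianProcess X P) (hXm : ∀ t, Measurable (X t)) {φ : Ω' → Ω}
    (hφ : MeasurePreserving φ Q P) : IsGaussianProcess (fun t ω => X t (φ ω)) Q := by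
  refine ⟨fun I => ⟨?_⟩⟩
  rw [show (fun ω => I.restrict fun t => X t (φ ω)) = (fun ω => I.restrict fun t => X t ω) ∘ φ
      from rfl, ← Measure.map_map (measurable_pi_lambda (fun ω => I.restrict fun t => X t ω)
      fun t => hXm t.1) hφ.measurable, hφ.map_eq]
  exact (hX.hasGaussianLaw I).isGaussian_map

/-- **Two real Gaussian processes (on possibly different probability spaces) with the same mean and
covariance functions have the same law** (Kallenberg, *Foundations* (2002), Lemma 13.1): the tree's
`IsGaussianProcess.map_eq_of_covariance_eq` applied to the two pulled-back processes on the product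
space. -/
theorem map_eq_map_of_isGaussianProcess {T Ω₁ Ω₂ : Type*} [MeasurableSpace Ω₁] [MeasurableSpace Ω₂]
    {P₁ : Measure Ω₁} {P₂ : Measure Ω₂} [IsProbabilityMeasure P₁] [IsProbabilityMeasure P₂]
    {X : T → Ω₁ → ℝ} {W : T → Ω₂ → ℝ} (hX : IsGaussianProcess X P₁) (hW : IsGaussianProcess W P₂)
    (hXm : ∀ t, Measurable (X t)) (hWm : ∀ t, Measurable (W t))
    (hm : ∀ t, ∫ ω, X t ω ∂P₁ = ∫ ω, W t ω ∂P₂)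
    (hc : ∀ s t, cov[X s, X t; P₁] = cov[W s, W t; P₂]) :
    P₁.map (fun ω t => X t ω) = P₂.map (fun ω t => W t ω) := by
  have h1 : MeasurePreserving Prod.fst (P₁.prod P₂) P₁ := measurePreserving_fst
  have h2 : MeasurePreserving Prod.snd (P₁.prod P₂) P₂ := measurePreserving_snd
  have hm' : ∀ t, ∫ ω, X t ω.1 ∂P₁.prod P₂ = ∫ ω, W t ω.2 ∂P₁.prod P₂ := fun t => by
    rw [integral_fun_fst, integral_fun_snd]
    simp [hm t]
  have hc' : ∀ s t, cov[fun ω => X s ω.1, fun ω => X t ω.1; P₁.prod P₂] =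
      cov[fun ω => W s ω.2, fun ω => W t ω.2; P₁.prod P₂] := fun s t => by
    rw [← covariance_map_fun (μ := P₁.prod P₂) (hXm s).aestronglyMeasurable
        (hXm t).aestronglyMeasurable measurable_fst.aemeasurable, h1.map_eq,
      ← covariance_map_fun (μ := P₁.prod P₂) (hWm s).aestronglyMeasurable
        (hWm t).aestronglyMeasurable measurable_snd.aemeasurable, h2.map_eq, hc]
  have key := (isGaussianProcess_comp_measurePreserving hX hXm h1).map_eq_of_covariance_eq
    (isGaussianProcess_comp_measurePreserving hW hWm h2) hm' hc'
    (measurable_pi_lambda _ fun t => (hXm t).comp measurable_fst).aemeasurable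
    (measurable_pi_lambda _ fun t => (hWm t).comp measurable_snd).aemeasurable
  calc P₁.map (fun ω t => X t ω)
      = ((P₁.prod P₂).map Prod.fst).map (fun ω t => X t ω) := by rw [h1.map_eq]
    _ = (P₁.prod P₂).map (fun ω t => X t ω.1) :=
        Measure.map_map (measurable_pi_lambda _ hXm) measurable_fst
    _ = (P₁.prod P₂).map (fun ω t => W t ω.2) := key
    _ = ((P₁.prod P₂).map Prod.snd).map (fun ω t => W t ω) :=
        (Measure.map_map (measurable_pi_lambda _ hWm) measurable_snd).symm
    _ = P₂.map (fun ω t => W t ω) := by rw [h2.map_eq]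

/-! ### The two-plaquette Gaussian computation -/

/-- `|curvatureTwoPoint p q| ≤ 1/2` in `d = 4`: the variances of `Y_p^0 ± Y_q^0` under the
one-colour curvature field are `1 ± 2 curvatureTwoPoint p q ≥ 0`. -/
theorem half_add_nonneg (p q : ZdPlaquette 4) :
    0 ≤ 1 / 2 + curvatureTwoPoint p q ∧ 0 ≤ 1 / 2 - curvatureTwoPoint p q := by
  have hd : 3 ≤ 4 := by norm_num
  haveI := isProbabilityMeasure_curvatureGaussianField hd 1
  have hG := isGaussianProcess_eval_curvatureGaussianField hd 1
  have hX : MemLp (fun ω : ZdPlaquette 4 → Fin 1 → ℝ => ω p 0) 2 (curvatureGaussianField 4 1) :=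
    (hG.hasGaussianLaw_eval (p, 0)).memLp_two
  have hY : MemLp (fun ω : ZdPlaquette 4 → Fin 1 → ℝ => ω q 0) 2 (curvatureGaussianField 4 1) :=
    (hG.hasGaussianLaw_eval (q, 0)).memLp_two
  have h1 := variance_nonneg ((fun ω : ZdPlaquette 4 → Fin 1 → ℝ => ω p 0) + fun ω => ω q 0)
    (curvatureGaussianField 4 1)
  have h2 := variance_nonneg ((fun ω : ZdPlaquette 4 → Fin 1 → ℝ => ω p 0) - fun ω => ω q 0)
    (curvatureGaussianField 4 1)
  rw [variance_add hX hY] at h1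
  rw [variance_sub hX hY] at h2
  rw [variance_eval_curvatureGaussianField hd, variance_eval_curvatureGaussianField hd,
    covariance_eval_curvatureGaussianField hd, if_pos rfl] at h1 h2
  constructor <;> norm_num at h1 h2 ⊢ <;> linarith

/-- **Law transfer.** For a measurable test function `G` of the `Fin D ⊕ Fin D`-indexed coordinates
`(Y_p^a)_a, (Y_q^a)_a`, its `ν`-expectation equals the expectation of `G` at the model variables
`(ξ_a + η_a)_a, (ξ_a - η_a)_a`, `ξ_a ∼ N(0, (1/2 + c)/2)`, `η_a ∼ N(0, (1/2 - c)/2)` independent,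
`c = curvatureTwoPoint p q`: both families are centred Gaussian processes with the same
covariances. -/
theorem integral_eq_integral_model (D : ℕ) (p q : ZdPlaquette 4) {G : (Fin D ⊕ Fin D → ℝ) → ℝ}
    (hG : Measurable G) :
    ∫ Y, G (Sum.elim (Y p) (Y q)) ∂curvatureGaussianField 4 D =
      ∫ z, G (Sum.elim (fun a => z (Sum.inl a) + 1 * z (Sum.inr a))
          fun a => z (Sum.inl a) + (-1) * z (Sum.inr a))
        ∂Measure.pi fun k : Fin D ⊕ Fin D => gaussianReal 0
          (Sum.elim (fun _ => ((1 / 2 + curvatureTwoPoint p q) / 2).toNNReal)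
            (fun _ => ((1 / 2 - curvatureTwoPoint p q) / 2).toNNReal) k) := by
  have hd : 3 ≤ 4 := by norm_num
  haveI := isProbabilityMeasure_curvatureGaussianField hd D
  obtain ⟨hcp, hcm⟩ := half_add_nonneg p q
  set v : Fin D ⊕ Fin D → ℝ≥0 := Sum.elim (fun _ => ((1 / 2 + curvatureTwoPoint p q) / 2).toNNReal)
    (fun _ => ((1 / 2 - curvatureTwoPoint p q) / 2).toNNReal) with hv
  have hvl : ∀ a, (v (Sum.inl a) : ℝ) = (1 / 2 + curvatureTwoPoint p q) / 2 := fun a =>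
    Real.coe_toNNReal _ (by linarith)
  have hvr : ∀ a, (v (Sum.inr a) : ℝ) = (1 / 2 - curvatureTwoPoint p q) / 2 := fun a =>
    Real.coe_toNNReal _ (by linarith)
  have hI : ∀ i, Integrable (fun z : Fin D ⊕ Fin D → ℝ => z i)
      (Measure.pi fun k => gaussianReal 0 (v k)) := fun i => (hasGaussianLaw_eval_pi v i).integrable
  have hXm : ∀ t, Measurable fun Y : ZdPlaquette 4 → Fin D → ℝ => Sum.elim (Y p) (Y q) t := by
    rintro (a | a) <;> exact (measurable_pi_apply _).comp (measurable_pi_apply _)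
  have hWm : ∀ t, Measurable fun z : Fin D ⊕ Fin D → ℝ =>
      Sum.elim (fun a => z (Sum.inl a) + 1 * z (Sum.inr a))
        (fun a => z (Sum.inl a) + (-1) * z (Sum.inr a)) t := by
    rintro (a | a) <;> simp only [Sum.elim_inl, Sum.elim_inr] <;> fun_prop
  have hlaw : (curvatureGaussianField 4 D).map (fun Y => Sum.elim (Y p) (Y q)) =
      (Measure.pi fun k => gaussianReal 0 (v k)).map (fun z =>
        Sum.elim (fun a => z (Sum.inl a) + 1 * z (Sum.inr a))
          (fun a => z (Sum.inl a) + (-1) * z (Sum.inr a))) := by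
    refine map_eq_map_of_isGaussianProcess
      (X := fun (t : Fin D ⊕ Fin D) (Y : ZdPlaquette 4 → Fin D → ℝ) => Sum.elim (Y p) (Y q) t)
      (W := fun (t : Fin D ⊕ Fin D) (z : Fin D ⊕ Fin D → ℝ) =>
        Sum.elim (fun a => z (Sum.inl a) + 1 * z (Sum.inr a))
          (fun a => z (Sum.inl a) + (-1) * z (Sum.inr a)) t) ?_ ?_ hXm hWm ?_ ?_
    · exact ((isGaussianProcess_eval_curvatureGaussianField hd D).comp_right
        (Sum.elim (fun a => (p, a)) fun a => (q, a))).congr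
        (by rintro (a | a) <;> exact Filter.EventuallyEq.rfl)
    · classical
      refine (isGaussianProcess_eval_pi v).of_isGaussianProcess ?_
      rintro (a | a)
      · exact ⟨{Sum.inl a, Sum.inr a},
          .proj ⟨Sum.inl a, by simp⟩ + (1 : ℝ) • .proj ⟨Sum.inr a, by simp⟩, fun z => by simp⟩
      · exact ⟨{Sum.inl a, Sum.inr a},
          .proj ⟨Sum.inl a, by simp⟩ + (-1 : ℝ) • .proj ⟨Sum.inr a, by simp⟩, fun z => by simp⟩
    · rintro (a | a) <;> simp only [Sum.elim_inl, Sum.elim_inr] <;>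
        rw [integral_eval_curvatureGaussianField hd, integral_add (hI _) ((hI _).const_mul _),
          integral_const_mul, integral_eval_pi, integral_eval_pi] <;> simp
    · rintro (a | a) (a' | a') <;> simp only [Sum.elim_inl, Sum.elim_inr] <;>
        rw [covariance_eval_curvatureGaussianField hd, covariance_model] <;>
        simp only [hvl, hvr, curvatureTwoPoint_self hd, curvatureTwoPoint_comm q p] <;>
        split_ifs <;> norm_num <;> ring
  rw [← integral_map (measurable_pi_lambda _ hXm).aemeasurable hG.aestronglyMeasurable, hlaw,
    integral_map (measurable_pi_lambda _ hWm).aemeasurable hG.aestronglyMeasurable]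

/-- **The joint Gaussian moment**: `E_ν[e^{-s|Y_p|²} e^{-s|Y_q|²}] =
(1 + 2s(1/2 + c))^{-D/2} (1 + 2s(1/2 - c))^{-D/2}`, `c = curvatureTwoPoint p q`, `s ≥ 0`. -/
theorem integral_exp_mul_exp (D : ℕ) (p q : ZdPlaquette 4) {s : ℝ} (hs : 0 ≤ s) :
    ∫ Y, Real.exp (-(s * ∑ a, Y p a ^ 2)) * Real.exp (-(s * ∑ a, Y q a ^ 2))
        ∂curvatureGaussianField 4 D =
      ((1 + 2 * s * (1 / 2 + curvatureTwoPoint p q)) ^ (-(1 / 2 : ℝ))) ^ D *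
        ((1 + 2 * s * (1 / 2 - curvatureTwoPoint p q)) ^ (-(1 / 2 : ℝ))) ^ D := by
  obtain ⟨hcp, hcm⟩ := half_add_nonneg p q
  have h2s : (0 : ℝ) ≤ 2 * s := by positivity
  have hGm : Measurable fun u : Fin D ⊕ Fin D → ℝ =>
      Real.exp (-(s * ∑ a, u (Sum.inl a) ^ 2)) * Real.exp (-(s * ∑ a, u (Sum.inr a) ^ 2)) := by
    fun_prop
  have h1 := integral_eq_integral_model D p q hGm
  simp only [Sum.elim_inl, Sum.elim_inr] at h1
  rw [h1]
  have h3 : ∀ z : Fin D ⊕ Fin D → ℝ,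
      Real.exp (-(s * ∑ a, (z (Sum.inl a) + 1 * z (Sum.inr a)) ^ 2)) *
        Real.exp (-(s * ∑ a, (z (Sum.inl a) + (-1) * z (Sum.inr a)) ^ 2)) =
      ∏ i, Real.exp (-(2 * s * z i ^ 2)) := by
    intro z
    rw [← Real.exp_add, ← Real.exp_sum, Fintype.sum_sum_type]
    congr 1
    simp only [Finset.mul_sum, ← Finset.sum_neg_distrib, ← Finset.sum_add_distrib]
    exact Finset.sum_congr rfl fun a _ => by ring
  simp_rw [h3]
  rw [integral_fintype_prod_eq_prod (f := fun _ x => Real.exp (-(2 * s * x ^ 2)))]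
  simp_rw [integral_exp_neg_mul_sq _ h2s]
  rw [Fintype.prod_sum_type]
  simp only [Sum.elim_inl, Sum.elim_inr, Finset.prod_const, Finset.card_univ, Fintype.card_fin,
    Real.coe_toNNReal _ (by linarith : 0 ≤ (1 / 2 + curvatureTwoPoint p q) / 2),
    Real.coe_toNNReal _ (by linarith : 0 ≤ (1 / 2 - curvatureTwoPoint p q) / 2)]
  have e1 : 1 + 2 * (2 * s) * ((1 / 2 + curvatureTwoPoint p q) / 2) =
      1 + 2 * s * (1 / 2 + curvatureTwoPoint p q) := by ring
  have e2 : 1 + 2 * (2 * s) * ((1 / 2 - curvatureTwoPoint p q) / 2) =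
      1 + 2 * s * (1 / 2 - curvatureTwoPoint p q) := by ring
  rw [e1, e2]

/-- **The one-plaquette Gaussian moment**: `E_ν[e^{-|Y_p|²}] = 2^{-D/2}` (the `q = p`, `s = 1/2`
case of `integral_exp_mul_exp`, `curvatureTwoPoint p p = 1/2`). -/
theorem integral_exp (D : ℕ) (p : ZdPlaquette 4) :
    ∫ Y, Real.exp (-∑ a, Y p a ^ 2) ∂curvatureGaussianField 4 D =
      ((2 : ℝ) ^ (-(1 / 2 : ℝ))) ^ D := by
  have h := integral_exp_mul_exp D p p (s := 1 / 2) (by norm_num)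
  rw [curvatureTwoPoint_self (by norm_num) p] at h
  have e : ∀ Y : ZdPlaquette 4 → Fin D → ℝ, Real.exp (-(1 / 2 * ∑ a, Y p a ^ 2)) *
      Real.exp (-(1 / 2 * ∑ a, Y p a ^ 2)) = Real.exp (-∑ a, Y p a ^ 2) := fun Y => by
    rw [← Real.exp_add]
    congr 1
    ring
  simp_rw [e] at h
  rw [h]
  norm_num

/-- **The Gaussian covariance of the probes**: for any two plaquettes `p, q` of `ℤ⁴`,
`Cov_ν(e^{-|Y_p|²}, e^{-|Y_q|²}) = 2^{-D} ((1 - c²)^{-D/2} - 1)` with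
`c = curvatureTwoPoint p q`. -/
theorem covariance_formula (D : ℕ) (p q : ZdPlaquette 4) :
    (∫ Y, Real.exp (-∑ a, Y p a ^ 2) * Real.exp (-∑ a, Y q a ^ 2) ∂curvatureGaussianField 4 D) -
        (∫ Y, Real.exp (-∑ a, Y p a ^ 2) ∂curvatureGaussianField 4 D) *
          ∫ Y, Real.exp (-∑ a, Y q a ^ 2) ∂curvatureGaussianField 4 D =
      (2 : ℝ) ^ (-(D : ℝ)) * ((1 - curvatureTwoPoint p q ^ 2) ^ (-((D : ℝ) / 2)) - 1) := by
  obtain ⟨hcp, hcm⟩ := half_add_nonneg p q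
  have hJ := integral_exp_mul_exp D p q zero_le_one
  simp only [one_mul, mul_one] at hJ
  rw [hJ, integral_exp, integral_exp]
  have hr : ∀ x : ℝ, 0 ≤ x → (x ^ (-(1 / 2 : ℝ))) ^ D = x ^ (-((D : ℝ) / 2)) := fun x hx => by
    rw [← Real.rpow_natCast, ← Real.rpow_mul hx]
    congr 1
    ring
  have hA : ((1 + 2 * (1 / 2 + curvatureTwoPoint p q)) ^ (-(1 / 2 : ℝ))) ^ D =
      (1 + 2 * (1 / 2 + curvatureTwoPoint p q)) ^ (-((D : ℝ) / 2)) := hr _ (by linarith)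
  have hB : ((1 + 2 * (1 / 2 - curvatureTwoPoint p q)) ^ (-(1 / 2 : ℝ))) ^ D =
      (1 + 2 * (1 / 2 - curvatureTwoPoint p q)) ^ (-((D : ℝ) / 2)) := hr _ (by linarith)
  have hC : ((2 : ℝ) ^ (-(1 / 2 : ℝ))) ^ D = 2 ^ (-((D : ℝ) / 2)) := hr _ (by norm_num)
  have e1 : (1 + 2 * (1 / 2 + curvatureTwoPoint p q)) * (1 + 2 * (1 / 2 - curvatureTwoPoint p q)) =
      2 ^ (2 : ℝ) * (1 - curvatureTwoPoint p q ^ 2) := by norm_num; ring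
  have e2 : -((D : ℝ) / 2) + -((D : ℝ) / 2) = -(D : ℝ) := by ring
  have e3 : (2 : ℝ) * -((D : ℝ) / 2) = -(D : ℝ) := by ring
  have h1c : 0 ≤ 1 - curvatureTwoPoint p q ^ 2 := by nlinarith [mul_nonneg hcp hcm]
  rw [hA, hB, hC, ← Real.mul_rpow (by linarith) (by linarith), e1,
    Real.mul_rpow (by positivity) h1c, ← Real.rpow_mul (by norm_num), e3,
    ← Real.rpow_add (by norm_num : (0 : ℝ) < 2), e2]
  ring

end GaussianProfile

/-- **Stub `stub_gaussianProfile`** of line `Sketch`: under the curvature Gaussian field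
`ν = curvatureGaussianField 4 D` the covariance of the probes `e^{-|Y_{p₀}|²}`, `e^{-|Y_{p_n}|²}`
at the plaquettes `p₀ = (0; 1, 2)` and `p_n = (n e₀; 1, 2)` of `ℤ⁴` is
`2^{-D} ((1 - c_n²)^{-D/2} - 1)`, `c_n = curvaturePlaquetteCorr _ n`
(`GaussianProfile.covariance_formula` with `c_n = curvatureTwoPoint p₀ p_n` by `rfl`). -/
theorem stub_gaussianProfile :
    ∀ (D n : ℕ),
      (∫ Y, Real.exp (-(∑ a : Fin D,
            (Y (Literature.MathematicalPhysics.QuantumFieldTheory.plaquette12 (d := 4)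
              (by norm_num) 0) a) ^ 2)) *
          Real.exp (-(∑ a : Fin D,
            (Y (Literature.MathematicalPhysics.QuantumFieldTheory.plaquette12 (d := 4)
              (by norm_num) (Pi.single (0 : Fin 4) (n : ℤ) :
                Literature.Probability.LatticeModels.Site 4)) a) ^ 2))
          ∂(Literature.MathematicalPhysics.QuantumFieldTheory.curvatureGaussianField 4 D)) -
        (∫ Y, Real.exp (-(∑ a : Fin D,
            (Y (Literature.MathematicalPhysics.QuantumFieldTheory.plaquette12 (d := 4)
              (by norm_num) 0) a) ^ 2))
          ∂(Literature.MathematicalPhysics.QuantumFieldTheory.curvatureGaussianField 4 D)) *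
        (∫ Y, Real.exp (-(∑ a : Fin D,
            (Y (Literature.MathematicalPhysics.QuantumFieldTheory.plaquette12 (d := 4)
              (by norm_num) (Pi.single (0 : Fin 4) (n : ℤ) :
                Literature.Probability.LatticeModels.Site 4)) a) ^ 2))
          ∂(Literature.MathematicalPhysics.QuantumFieldTheory.curvatureGaussianField 4 D)) =
      (2 : ℝ) ^ (-(D : ℝ)) *
        ((1 - (Literature.MathematicalPhysics.QuantumFieldTheory.curvaturePlaquetteCorr
            (d := 4) (by norm_num) (n : ℤ)) ^ 2) ^ (-((D : ℝ) / 2)) - 1) := by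
  exact fun D _ => GaussianProfile.covariance_formula D _ _

end Summit.QuantumFields.YangMills.Theorems.EquipartitionPinsProbe

end
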